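import Summits.BirchSwinnertonDyer.BirchSwinnertonDyer.Theorems.QuadraticBranchSignedControlPlusEtaNonsurjMultiplicativeCongruence
import Summits.BirchSwinnertonDyer.Rank1Residual.X2.GreenbergVatsalTateFrobeniusSign
import Literature.NumberTheory.EllipticCurves.TateCurve.NumberFieldUniformization
import Literature.NumberTheory.EllipticCurves.BSDConductorProofs
import HarnessLib

/-!
# Route `QuadraticBranchSignedControl` (rung K8, cell `bsd-potss`): crux stmt-BirchSwinnertonDyer-19606
# `PlusEtaMainConjectureNonsurj` — THE SIGN OF THE TATE EIGENVECTOR IS THE SPLITTING TYPE OF THE NODE: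
# eigenvalue `+ℓ` at a split, `−ℓ` at a non-split multiplicative place (part 3a of «multiplicative primes `≡ ±1 mod p`»)

WHAT. Sequel to `…PlusEtaNonsurjMultiplicativeFrobenius` (part 1: a rational eigenvector `Ψ(ζ_p) ∈ W[p]` of eigenvalue
`± ℓ` for the restriction `σ₁ = τ|_{ℚ̄}` of a local arithmetic Frobenius at a multiplicative place `v ∤ p`, `char v = ℓ`)
and `…MultiplicativeCongruence` (part 2). Here the SIGN is identified with the splitting type of the node:

* §5 `exists_eigenvector_resGalOfEmb_of_uniformizer` — ENGINE: any uniformiser `Ψ : ℚ̄_v^× → W(ℚ̄_v)` with kernel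
  `q^ℤ` and `τ • Ψ(u) = z • Ψ(τ u)` yields a non-zero `P ∈ W[p]` with `σ₁ • P = (z ℓ) • P`;
  **`exists_eigenvector_resGalOfEmb_of_hasSplitMultiplicativeReductionAt`** — at a SPLIT place `σ₁ • P = ℓ • P`
  (untwisted Tate uniformisation, Silverman *ATAEC* V.5.3 / V.3.1, tree theorem
  `TateCurve.Silverman1994_thmV53_tateUniformisation_holds`);
  **`exists_eigenvector_resGalOfEmb_of_not_hasSplitMultiplicativeReductionAtPrime`** — at a NON-SPLIT odd `ℓ`,
  `σ₁ • P = (−ℓ) • P` (twisted uniformisation `TateCurve.Silverman1994_thmV53_corV54_tateUniformisation_holds` and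
  the X2 cell's `GreenbergVatsalTateFrobeniusSign.frob_apply_sqrt_gamma_ne`: an arithmetic Frobenius flips `√γ`,
  `γ = −c₄/c₆`, so `χ(τ) = −1`).
* §6 matrix algebra for part 3b: `eq_smul_one_of_mem_nonsplitCartan_of_mulVec_eq` (an element of `C_ns(ε)` with a
  rational eigenvector is SCALAR), `mul_self_eq_neg_det_smul_one_of_not_mem_nonsplitCartan` (`M² = −det M` on the
  coset `C_ns⁺(ε) ∖ C_ns(ε)`).

The row consequences (`Frob_ℓ = a_ℓ(V) = ±1` on `V[p]` when `ℓ ≡ 1 (mod p)`, `Frob_ℓ² = 1` always, `ρ̄` unramified at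
`ℓ`) are in `…PlusEtaNonsurjMultiplicativeFrobeniusScalar` (part 3b).

HONEST FRAMING (cell `bsd-potss`, run/shared/lean/pub/bsd-potss/; FULL-BSD rank ≤ 1 programme): TOOL THEOREMS ONLY
(no definition, no named fact, no `sorry`, axioms standard). Nothing is booked; crux 19606 stays OPEN; `BSD(W, p)` is
claimed for no pair. Seat `bsd-potss-k8eta-c2` g12 (prover), `--supports stmt-BirchSwinnertonDyer-19606`.

References: [SilvermanATAEC1994] Thm. V.3.1 (c),(d), Lemma V.5.2 (c), Thm. V.5.3, Cor. V.5.4, Ex. 5.11 (b)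
(PDF pp. 395–410); [SilvermanAEC2009] VII.5 Prop. 5.1 (b); [Serre1972] §1.11–§1.12, §2.2.
-/

set_option autoImplicit false
set_option linter.dupNamespace false

noncomputable section

open scoped Classical NNReal Pointwise

open Matrix Field IsDedekindDomain NumberField WeierstrassCurve Literature.NumberTheory.EllipticCurves
  Literature.NumberTheory.GaloisRepresentations Literature.NumberTheory.SerreUniformity
  Rat.HeightOneSpectrum IsDedekindDomain.HeightOneSpectrum
  Summit.BirchSwinnertonDyer.Rank1Residual.X2

namespace Summit.BirchSwinnertonDyer.BirchSwinnertonDyer.Theorems.EtaCartanField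

/-! ## §5 The sign: `+1` at a split place, `−1` at a non-split place -/

section Sign

variable (W : WeierstrassCurve ℚ) [W.IsElliptic]

/-- **Engine.** For any uniformiser `Ψ : ℚ̄_v^× → W(ℚ̄_v)` with kernel `q^ℤ` (`0 < |q| < 1`) such that the given
`τ ∈ Γ_{ℚ_v}` — a local arithmetic Frobenius — satisfies `τ • Ψ(u) = z • Ψ(τ u)` for all `u`, the restriction
`σ₁ = τ|_{ℚ̄}` has a NON-ZERO `P ∈ W[p]` with `σ₁ • P = (z ℓ) • P` (`P ↦ Ψ(ζ_p)` under `ι_*`; `χ_p(σ₁) = ℓ`).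
[cite: SilvermanATAEC1994, Thm. V.3.1 (c),(d), Lemma V.5.2 (c), Thm. V.5.3, Cor. V.5.4 (PDF pp. 395–410)] -/
theorem exists_eigenvector_resGalOfEmb_of_uniformizer
    {v : HeightOneSpectrum (𝓞 ℚ)} {p ℓ : ℕ} (hp : p.Prime) (hv : (primesEquiv v : ℕ) = ℓ) (hℓp : ℓ ≠ p)
    {𝔐 : Ideal v.localAbsIntegers} (h𝔐 : 𝔐 ∈ v.localPrimesAbove)
    {τ : absoluteGaloisGroup (v.adicCompletion ℚ)} (hτ : IsArithFrobAt (v.adicCompletionIntegers ℚ) τ 𝔐)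
    {q : v.adicCompletion ℚ} (hq0 : q ≠ 0) (hq1 : Valued.v q < 1)
    {Ψ : Additive (AlgebraicClosure (v.adicCompletion ℚ))ˣ →+ localPoints W (v.adicCompletion ℚ)}
    (hker : ∀ u : (AlgebraicClosure (v.adicCompletion ℚ))ˣ, Ψ (Additive.ofMul u) = 0 ↔
      ∃ n : ℤ, (u : AlgebraicClosure (v.adicCompletion ℚ)) =
        algebraMap (v.adicCompletion ℚ) (AlgebraicClosure (v.adicCompletion ℚ)) q ^ n)
    {z : ℤ} (hΨτ : ∀ u : (AlgebraicClosure (v.adicCompletion ℚ))ˣ, τ • Ψ (Additive.ofMul u) =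
      z • Ψ (Additive.ofMul (Units.map (Field.absoluteGaloisGroup.toAlgEquiv (v.adicCompletion ℚ) τ :
        AlgebraicClosure (v.adicCompletion ℚ) →* AlgebraicClosure (v.adicCompletion ℚ)) u))) :
    ∃ P : geomTorsion W (p : ℤ), P ≠ 0 ∧
      resGalOfEmb (closureEmb (K := ℚ) (v.adicCompletion ℚ)) τ • P = (z * (ℓ : ℤ)) • P := by
  haveI : NeZero p := ⟨hp.ne_zero⟩
  haveI : Fact p.Prime := ⟨hp⟩
  haveI : CharZero (AlgebraicClosure (v.adicCompletion ℚ)) :=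
    charZero_of_injective_algebraMap (algebraMap ℚ (AlgebraicClosure (v.adicCompletion ℚ))).injective
  set ι := closureEmb (K := ℚ) (v.adicCompletion ℚ) with hι
  set σ₁ : absoluteGaloisGroup ℚ := resGalOfEmb ι τ with hσ₁
  -- a global primitive `p`-th root of unity; `σ₁ ζ = ζ^c` with `c ≡ ℓ (mod p)`
  obtain ⟨ζ, hζ⟩ := HasEnoughRootsOfUnity.exists_primitiveRoot (AlgebraicClosure ℚ) p
  set c : ℕ := ((modNCyclotomicCharacter ℚ p σ₁ : (ZMod p)ˣ) : ZMod p).val with hc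
  have hσζ : σ₁ • ζ = ζ ^ c := modNCyclotomicCharacter_spec ℚ p σ₁ ζ hζ.pow_eq_one
  have hcl : (c : ZMod p) = (ℓ : ZMod p) := by
    rw [hc, ZMod.natCast_zmod_val, hσ₁, hι, modNCyclotomicCharacter_resGalOfEmb_eq_of_isArithFrobAt hv hℓp h𝔐 hτ]
  -- the local root of unity `ζ' = ι ζ` and the action of `τ` on it
  set ζ' : AlgebraicClosure (v.adicCompletion ℚ) := ι ζ with hζ'def
  have hζ' : IsPrimitiveRoot ζ' p := hζ.map_of_injective ι.injective
  have hζ'0 : ζ' ≠ 0 := hζ'.ne_zero hp.ne_zero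
  set ζu : (AlgebraicClosure (v.adicCompletion ℚ))ˣ := Units.mk0 ζ' hζ'0 with hζu
  have hτζ : Field.absoluteGaloisGroup.toAlgEquiv (v.adicCompletion ℚ) τ ζ' = ζ' ^ c := by
    have h := apply_resGalAuxOfEmb_apply ι τ ζ
    change ι (σ₁ • ζ) = Field.absoluteGaloisGroup.toAlgEquiv (v.adicCompletion ℚ) τ ζ' at h
    rw [← h, hσζ, map_pow]
  have hτζu : Units.map (Field.absoluteGaloisGroup.toAlgEquiv (v.adicCompletion ℚ) τ :
      AlgebraicClosure (v.adicCompletion ℚ) →* AlgebraicClosure (v.adicCompletion ℚ)) ζu = ζu ^ c :=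
    Units.ext (by rw [Units.coe_map, MonoidHom.coe_coe, Units.val_pow_eq_pow_val, hζu, Units.val_mk0, hτζ])
  have hζup : ζu ^ p = 1 := Units.ext (by rw [Units.val_pow_eq_pow_val, hζu, Units.val_mk0, hζ'.pow_eq_one,
    Units.val_one])
  set P₁' : localPoints W (v.adicCompletion ℚ) := Ψ (Additive.ofMul ζu) with hP₁'
  have hpP₁' : p • P₁' = 0 := by
    rw [hP₁', ← map_nsmul, ← ofMul_pow, hζup, ofMul_one, map_zero]
  have hP₁'0 : P₁' ≠ 0 := by
    intro h0
    obtain ⟨n, hn⟩ := (hker ζu).mp h0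
    have hq' : ‖q‖ < 1 := Valued.toNormedField.norm_lt_one_iff.mpr hq1
    have h1 : algebraMap (v.adicCompletion ℚ) (AlgebraicClosure (v.adicCompletion ℚ)) q ^ (n * p) = 1 := by
      rw [_root_.zpow_mul, zpow_natCast, ← hn, hζu, Units.val_mk0, hζ'.pow_eq_one]
    have h2 := (TateCurve.zpow_algebraMap_eq_one_iff hq0 hq' _).mp h1
    have hn0 : n = 0 := by
      rcases mul_eq_zero.mp h2 with h | h
      · exact h
      · exact absurd h (by exact_mod_cast hp.ne_zero)
    rw [hn0, zpow_zero, hζu, Units.val_mk0] at hn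
    exact hζ'.ne_one hp.one_lt hn
  have hτP : τ • P₁' = (z * c) • P₁' := by
    rw [hP₁', hΨτ ζu, hτζu, ofMul_pow, map_nsmul, mul_zsmul, natCast_zsmul]
  -- globalise along `ι_*`
  obtain ⟨P, hpP, hPP⟩ := exists_pointsMapOfEmb_eq_of_nsmul_eq_zero W ι hp.ne_zero hpP₁'
  have hPmem : P ∈ geomTorsion W (p : ℤ) := (Submodule.mem_torsionBy_iff _ _).mpr (by
    change (p : ℤ) • P = 0; rw [natCast_zsmul, hpP])
  have hinj : Function.Injective (pointsMapOfEmb W ι) := pointsMapOfEmb_injective W ι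
  have hcP : (c : ℤ) • P₁' = (ℓ : ℤ) • P₁' := by
    have hdvd : (p : ℤ) ∣ (ℓ : ℤ) - (c : ℤ) := by
      rw [← ZMod.intCast_eq_intCast_iff_dvd_sub, Int.cast_natCast, Int.cast_natCast]
      exact hcl
    obtain ⟨k, hk⟩ := hdvd
    have hℓck : (ℓ : ℤ) = c + p * k := by linear_combination hk
    rw [hℓck, add_zsmul, mul_comm, mul_zsmul, natCast_zsmul P₁' p, hpP₁', zsmul_zero, add_zero]
  refine ⟨⟨P, hPmem⟩, fun h0 => hP₁'0 ?_, Subtype.ext ?_⟩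
  · have hP0 : P = 0 := by simpa using congrArg Subtype.val h0
    rw [← hPP, hP0, map_zero]
  · rw [Literature.NumberTheory.EllipticCurves.AddSubgroup.torsionBy.coe_smul, AddSubgroupClass.coe_zsmul]
    change σ₁ • P = (z * (ℓ : ℤ)) • P
    apply hinj
    rw [hσ₁, pointsMapOfEmb_smul, hPP, hτP, map_zsmul, hPP, mul_zsmul, mul_zsmul, hcP]

/-- **SPLIT place: eigenvalue `+ℓ`.** At a place `v ∤ p` of SPLIT multiplicative reduction the restriction `σ₁` of a
local arithmetic Frobenius has a non-zero `P ∈ W[p]` with `σ₁ • P = ℓ • P` (untwisted Tate uniformisation,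
`TateCurve.Silverman1994_thmV53_tateUniformisation_holds`). [cite: SilvermanATAEC1994, Thm. V.5.3, Thm. V.3.1 (c),(d) (PDF pp. 395, 407–409)] -/
theorem exists_eigenvector_resGalOfEmb_of_hasSplitMultiplicativeReductionAt
    {v : HeightOneSpectrum (𝓞 ℚ)} (hsplit : W.HasSplitMultiplicativeReductionAt v) {p ℓ : ℕ} (hp : p.Prime)
    (hv : (primesEquiv v : ℕ) = ℓ) (hℓp : ℓ ≠ p) {𝔐 : Ideal v.localAbsIntegers} (h𝔐 : 𝔐 ∈ v.localPrimesAbove)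
    {τ : absoluteGaloisGroup (v.adicCompletion ℚ)} (hτ : IsArithFrobAt (v.adicCompletionIntegers ℚ) τ 𝔐) :
    ∃ P : geomTorsion W (p : ℤ), P ≠ 0 ∧
      resGalOfEmb (closureEmb (K := ℚ) (v.adicCompletion ℚ)) τ • P = (ℓ : ℤ) • P := by
  obtain ⟨q, Φ, hq0, hq1, -, hker, hΦσ, -⟩ := TateCurve.Silverman1994_thmV53_tateUniformisation_holds W v hsplit
  obtain ⟨P, hP0, hP⟩ := exists_eigenvector_resGalOfEmb_of_uniformizer W hp hv hℓp h𝔐 hτ hq0 hq1 hker (z := 1)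
    (fun u => by rw [hΦσ, one_zsmul])
  exact ⟨P, hP0, by rwa [one_mul] at hP⟩

/-- **NON-SPLIT place (odd `ℓ`): eigenvalue `−ℓ`.** For `W/ℚ` globally minimal with NON-split multiplicative reduction
at the odd prime `ℓ ≠ p`, the restriction `σ₁` of a local arithmetic Frobenius has a non-zero `P ∈ W[p]` with
`σ₁ • P = (−ℓ) • P`: in the twisted uniformisation the sign `χ(τ)` is `−1` because `τ` flips `√γ`
(`GreenbergVatsalTateFrobeniusSign.frob_apply_sqrt_gamma_ne`). [cite: SilvermanATAEC1994, Lemma V.5.2 (c), Thm. V.5.3, Cor. V.5.4, Ex. 5.11 (b) (PDF pp. 406–410)]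
[cite: SilvermanAEC2009, VII.5 Prop. 5.1(b)] -/
theorem exists_eigenvector_resGalOfEmb_of_not_hasSplitMultiplicativeReductionAtPrime [W.IsGloballyMinimal]
    {p ℓ : ℕ} [hℓ : Fact ℓ.Prime] (hp : p.Prime) (hℓ2 : ℓ ≠ 2) (hℓp : ℓ ≠ p)
    (hmult : W.HasMultiplicativeReductionAtPrime ℓ) (hns : ¬ W.HasSplitMultiplicativeReductionAtPrime ℓ)
    {v : HeightOneSpectrum (𝓞 ℚ)} (hv : (primesEquiv v : ℕ) = ℓ) {𝔐 : Ideal v.localAbsIntegers}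
    (h𝔐 : 𝔐 ∈ v.localPrimesAbove) {τ : absoluteGaloisGroup (v.adicCompletion ℚ)}
    (hτ : IsArithFrobAt (v.adicCompletionIntegers ℚ) τ 𝔐) :
    ∃ P : geomTorsion W (p : ℤ), P ≠ 0 ∧
      resGalOfEmb (closureEmb (K := ℚ) (v.adicCompletion ℚ)) τ • P = (-(ℓ : ℤ)) • P := by
  have hmultAt : W.HasMultiplicativeReductionAt v := hasMultiplicativeReductionAt_of_primesEquiv_eq W hmult hv
  have hpv : ((ℓ : ℕ) : 𝓞 ℚ) ∈ v.asIdeal :=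
    (natCast_mem_asIdeal_iff_eq_primesEquiv_symm v hℓ.out).mpr ((Equiv.eq_symm_apply _).mpr (Subtype.ext hv))
  obtain ⟨q, t, Ψ, hq0, hq1, ht0, ht2, -, hker, hΨσ, -⟩ :=
    TateCurve.Silverman1994_thmV53_corV54_tateUniformisation_holds W v hmultAt
  have hflip := GreenbergVatsalTateFrobeniusSign.frob_apply_sqrt_gamma_ne W hℓ2 hmult hns hpv h𝔐 hτ t ht0 ht2
  obtain ⟨P, hP0, hP⟩ := exists_eigenvector_resGalOfEmb_of_uniformizer W hp hv hℓp h𝔐 hτ hq0 hq1 hker (z := -1)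
    (fun u => by rw [hΨσ τ u, if_neg hflip])
  exact ⟨P, hP0, by rwa [neg_one_mul] at hP⟩

end Sign

/-! ## §6 Matrix algebra: rational eigenvector in the Cartan ⟹ scalar; square on the coset -/

section MatrixAlgebra

variable {p : ℕ} [hp : Fact p.Prime]

/-- **An element of `C_ns(ε)` with a rational eigenvector is scalar**: if `M = (a, εb; b, a)` (`ε` a non-square) has a
non-zero `x` with `M x = c x`, then `b = 0` and `M = c·1`. [cite: Serre1972, §2.2] -/
theorem eq_smul_one_of_mem_nonsplitCartan_of_mulVec_eq {ε : ZMod p} (hε : ¬ IsSquare ε)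
    {M : Matrix (Fin 2) (Fin 2) (ZMod p)} (hM : M ∈ nonsplitCartan ε) {x : Fin 2 → ZMod p} (hx : x ≠ 0)
    {c : ZMod p} (hMx : M *ᵥ x = c • x) : M = c • (1 : Matrix (Fin 2) (Fin 2) (ZMod p)) := by
  obtain ⟨a, b, -, rfl⟩ := hM
  have h1 : a * x 0 + ε * b * x 1 = c * x 0 := by
    have := congrFun hMx 0
    simpa [Matrix.mulVec, dotProduct, Fin.sum_univ_two, mul_assoc] using this
  have h2 : b * x 0 + a * x 1 = c * x 1 := by
    have := congrFun hMx 1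
    simpa [Matrix.mulVec, dotProduct, Fin.sum_univ_two] using this
  have hb : b = 0 := by
    by_contra hb
    apply hε
    have hx1 : x 1 ≠ 0 := by
      intro hx1
      rw [hx1, mul_zero, mul_zero, add_zero] at h2
      have hx0 : x 0 = 0 := by
        rcases mul_eq_zero.mp h2 with h | h
        · exact absurd h hb
        · exact h
      exact hx (funext fun i => by fin_cases i <;> assumption)
    refine ⟨(c - a) / b, ?_⟩
    have key : ε * b * x 1 * b = (c - a) * ((c - a) * x 1) := by
      have e0 : b * x 0 = (c - a) * x 1 := by linear_combination h2
      have e1 : ε * b * x 1 = (c - a) * x 0 := by linear_combination h1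
      calc ε * b * x 1 * b = (c - a) * (b * x 0) := by rw [e1]; ring
        _ = (c - a) * ((c - a) * x 1) := by rw [e0]
    field_simp
    have := mul_right_cancel₀ hx1 (show ε * b * b * x 1 = (c - a) * (c - a) * x 1 by linear_combination key)
    linear_combination this
  subst hb
  have ha : a = c := by
    by_cases hx0 : x 0 = 0
    · have hx1 : x 1 ≠ 0 := fun hx1 => hx (funext fun i => by fin_cases i <;> assumption)
      rw [zero_mul, zero_add] at h2
      exact mul_right_cancel₀ hx1 h2
    · rw [mul_zero, zero_mul, add_zero] at h1
      exact mul_right_cancel₀ hx0 h1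
  subst ha
  ext i j
  fin_cases i <;> fin_cases j <;> simp

/-- **On the coset `C_ns⁺(ε) ∖ C_ns(ε)`: `M² = −det M`** (`M = (c, −εd; d, −c)` has trace `0`; Cayley–Hamilton).
[cite: Serre1972, §2.2] -/
theorem mul_self_eq_neg_det_smul_one_of_not_mem_nonsplitCartan {ε : ZMod p}
    {M : Matrix (Fin 2) (Fin 2) (ZMod p)} (hM : M ∈ nonsplitCartanNormalizer ε) (hM' : M ∉ nonsplitCartan ε) :
    M * M = (-M.det) • (1 : Matrix (Fin 2) (Fin 2) (ZMod p)) := by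
  obtain ⟨c, d, -, rfl⟩ := exists_eq_coset_of_not_mem_nonsplitCartan hM hM'
  rw [Matrix.det_fin_two_of]
  ext i j
  fin_cases i <;> fin_cases j <;> simp [Matrix.mul_apply, Fin.sum_univ_two] <;> ring

end MatrixAlgebra

end Summit.BirchSwinnertonDyer.BirchSwinnertonDyer.Theorems.EtaCartanField

end
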